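import Summits.MatrixMultiplication.OmegaCensus.STPPKernelListerDataZ59
import Summits.MatrixMultiplication.OmegaCensus.STPPKernelListerSplit


/-!
# ω-census (abelian STPP census): kernel lister rows for `ℤ_59` (split form), file 24 of 43 (kernel computation)

HONEST FRAMING (pub-omega census; verbatim): lottery ticket; floor = certified bounds/negative ranges.
Census STRUCTURE (seat pub-omega-stpp-2 gen 29, 2026-08-29), family (b2).  One chunk of the root computation of the kernel lister at `n = 59` in split form
(`KLister.scanFirstSel2C`): light first blocks (part 2 of 8: 140 shapes), second blocks unrestricted.  Measured ≈ 0.2–1.2 s of kernel per thin first block (the `List.contains` selection itself costs 741·|sel1| comparisons).  Assembled in `STPPKernelListerCapstoneZ59.lean`.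
Pure finite computation; nothing here is progress on `ω`.
-/

namespace Summit.MatrixMultiplication.OmegaCensus.KLister

/-- First blocks of this file. [folklore] -/
def sel1Z59S24P2 : List Shape := [(47, 1, 1), (1, 1, 46), (1, 2, 23), (1, 23, 2), (1, 46, 1), (2, 1, 23), (2, 23, 1), (23, 1, 2), (23, 2, 1), (46, 1, 1), (1, 1, 45), (1, 3, 15), (1, 5, 9), (1, 9, 5), (1, 15, 3), (1, 45, 1), (3, 1, 15), (3, 15, 1), (5, 1, 9), (5, 9, 1), (9, 1, 5), (9, 5, 1), (15, 1, 3), (15, 3, 1), (45, 1, 1), (1, 1, 44), (1, 2, 22), (1, 4, 11), (1, 11, 4), (1, 22, 2), (1, 44, 1), (2, 1, 22), (2, 22, 1), (4, 1, 11), (4, 11, 1), (11, 1, 4), (11, 4, 1), (22, 1, 2), (22, 2, 1), (44, 1, 1), (1, 1, 43), (1, 43, 1), (43, 1, 1), (1, 1, 42), (1, 2, 21), (1, 3, 14), (1, 6, 7), (1, 7, 6), (1, 14, 3), (1, 21, 2), (1, 42, 1), (2, 1, 21), (2, 21, 1), (3, 1, 14), (3, 14, 1), (6, 1, 7), (6,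 7, 1), (7, 1, 6), (7, 6, 1), (14, 1, 3), (14, 3, 1), (21, 1, 2), (21, 2, 1), (42, 1, 1), (1, 1, 41), (1, 41, 1), (41, 1, 1), (1, 1, 40), (1, 2, 20), (1, 4, 10), (1, 5, 8), (1, 8, 5), (1, 10, 4), (1, 20, 2), (1, 40, 1), (2, 1, 20), (2, 20, 1), (4, 1, 10), (4, 10, 1), (5, 1, 8), (5, 8, 1), (8, 1, 5), (8, 5, 1), (10, 1, 4), (10, 4, 1), (20, 1, 2), (20, 2, 1), (40, 1, 1), (1, 1, 39), (1, 3, 13), (1, 13, 3), (1, 39, 1), (3, 1, 13), (3, 13, 1), (13, 1, 3), (13, 3, 1), (39, 1, 1), (1, 1, 38), (1, 2, 19), (1, 19, 2), (1, 38, 1), (2, 1, 19), (2, 19, 1), (19, 1, 2), (19, 2, 1), (38, 1, 1), (1, 1, 37), (1, 37, 1), (37, 1, 1), (1, 1, 36), (1, 2, 18), (1, 3, 12), (1, 4, 9), (1, 6, 6), (1, 9, 4), (1, 12, 3), (1, 18, 2), (1, 36, 1), (2, 1, 18), (2, 18, 1), (3, 1, 12), (3, 12, 1), (4, 1, 9),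 (4, 9, 1), (6, 1, 6), (6, 6, 1), (9, 1, 4), (9, 4, 1), (12, 1, 3), (12, 3, 1), (18, 1, 2), (18, 2, 1), (36, 1, 1), (1, 1, 35), (1, 5, 7), (1, 7, 5), (1, 35, 1), (5, 1, 7), (5, 7, 1), (7, 1, 5)]


set_option maxRecDepth 32768 in
set_option maxHeartbeats 4000000 in
/-- Rows of the kernel lister at `59` (split form) for this file's selections. [folklore] -/
theorem scanSel_Z59_S24P2 :
    scanFirstSel2C 59 deadZ59 (fun s => sel1Z59S24P2.contains s) (fun _ => true) chunksZ59 = true := by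
  decide +kernel

end Summit.MatrixMultiplication.OmegaCensus.KLister
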